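import Mathlib.GroupTheory.SpecificGroups.Dihedral
import Mathlib.Data.Fintype.Pi
import Mathlib.Data.Fintype.BigOperators
import Literature.Combinatorics.Additive.TripleProductProperty
import Literature.Computability.AlgebraicComplexity.CohnUmansTPP
import HarnessLib

/-!
# Cohn–Umans 2003, Prop. 19 (arXiv numbering): Sperner-capacity sets give the TPP in `D_mᵏ`

Topic `Literature/Computability/AlgebraicComplexity` (group-theoretic matrix multiplication).  Source:
H. Cohn, C. Umans, *A group-theoretic approach to fast matrix multiplication*, FOCS 2003 = arXiv:math/0307321,
section "Direct products and the Sperner capacity" (held text `paper:arxiv-math_0307321`, chunk p0010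
L32–L100, read this session):

"Let `D_m` be the dihedral group generated by `x` and `y`, with the relations `y² = x^m = 1` and
`yxy = x⁻¹`. … **Proposition 19.** If `S ⊆ (ℤ/mℤ)ᵏ` is a subset in which no two distinct vectors differ by
an element of `{0,1}ᵏ`, then `D_mᵏ` realizes `⟨2ᵏ, 2ᵏ, |S|⟩`.  *Proof.* We identify `ℤ/mℤ` with the subgroup
`⟨x⟩ ⊆ D_m` (via `i ↔ xⁱ`), so that `S ⊆ ⟨x⟩ᵏ ⊆ D_mᵏ`. The subgroups `⟨y⟩` and `⟨yx⟩` of `D_m` have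
pointwise product `⟨y⟩⟨yx⟩ = {1, y, yx, x}`. Therefore the condition on differences of elements in `S`
implies that `⟨y⟩ᵏ`, `⟨yx⟩ᵏ`, and `S` satisfy the triple product property, since
`(⟨y⟩ᵏ⟨yx⟩ᵏ) ∩ ⟨x⟩ᵏ = {1, x}ᵏ`, and `Q(S) ⊆ ⟨x⟩ᵏ` avoids `{1, x}ᵏ`."  (It is "the first time … to realize
matrix multiplication through quotient sets that are not subgroups"; with a Sperner-capacity set of size
`(m−1)^{(1−o(1))k}` it yields Cor. 20, `α(D_4ᵏ) ≤ (3 + o(1)) log_12 8`, not formalised here.)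

## Formalisation

Mathlib's `DihedralGroup m` (`r i` = `xⁱ`, `sr i` = `yxⁱ`, so `y = sr 0`, `yx = sr 1`, `y·yx = r 1 = x`),
`D_mᵏ := Fin k → DihedralGroup m`.  `spernerY k = ⟨y⟩ᵏ`, `spernerYX k = ⟨yx⟩ᵏ` (boxes over `{1, sr 0}`,
`{1, sr 1}`), `rotationTuple v = (x^{vᵢ})ᵢ`.  The hypothesis "no two distinct vectors differ by an element of
`{0,1}ᵏ`" is `SpernerCondition S`.  We need `m ≠ 1` (for `D_1 ≅ C_2` one has `y = yx` and the statement
fails); the paper's `D_m` has `m ≥ 3`.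

* `CohnUmans2003_prop19_tpp` — the three sets satisfy the triple product property (tree's
  `TripleProductProperty`, CU03 Def. 2.1 elementwise);
* `CohnUmans2003_prop19` — **`D_mᵏ` realizes `⟨2ᵏ, 2ᵏ, |S|⟩`** (tree's `RealizesTPP`).

All proved; no named fact.

## References

* [CohnUmans2003] H. Cohn, C. Umans, FOCS 2003, 438–449 = arXiv:math/0307321, Prop. 19 and its proof
  (arXiv numbering; section "Direct products and the Sperner capacity"), Cor. 20.
-/

namespace Literature.Computability.AlgebraicComplexity

open Finset Literature.Combinatorics.Additive

namespace SpernerTPP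

variable {m : ℕ} {k : ℕ}

/-- `⟨y⟩ᵏ ⊆ D_mᵏ` with `y = sr 0`: the box of tuples with entries in `{1, y}`.
[cite: CohnUmans2003, Prop. 19 (arXiv numbering), proof] -/
def spernerY (m k : ℕ) : Finset (Fin k → DihedralGroup m) :=
  Fintype.piFinset fun _ => ({1, DihedralGroup.sr 0} : Finset (DihedralGroup m))

/-- `⟨yx⟩ᵏ ⊆ D_mᵏ` with `yx = sr 1`: the box of tuples with entries in `{1, yx}`.
[cite: CohnUmans2003, Prop. 19 (arXiv numbering), proof] -/
def spernerYX (m k : ℕ) : Finset (Fin k → DihedralGroup m) :=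
  Fintype.piFinset fun _ => ({1, DihedralGroup.sr 1} : Finset (DihedralGroup m))

/-- "We identify `ℤ/mℤ` with the subgroup `⟨x⟩ ⊆ D_m` (via `i ↔ xⁱ`)": the tuple of rotations `(x^{vᵢ})ᵢ`.
[cite: CohnUmans2003, Prop. 19 (arXiv numbering), proof] -/
def rotationTuple (v : Fin k → ZMod m) : Fin k → DihedralGroup m := fun i => DihedralGroup.r (v i)

/-- The image `S ⊆ ⟨x⟩ᵏ ⊆ D_mᵏ` of `S ⊆ (ℤ/mℤ)ᵏ`. [cite: CohnUmans2003, Prop. 19 (arXiv numbering), proof] -/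
def rotationSet (S : Finset (Fin k → ZMod m)) : Finset (Fin k → DihedralGroup m) :=
  S.image rotationTuple

/-- "`S ⊆ (ℤ/mℤ)ᵏ` is a subset in which no two distinct vectors differ by an element of `{0,1}ᵏ`".
[cite: CohnUmans2003, Prop. 19 (arXiv numbering)] -/
def SpernerCondition (S : Finset (Fin k → ZMod m)) : Prop :=
  ∀ u ∈ S, ∀ v ∈ S, (∀ i, v i - u i = 0 ∨ v i - u i = 1) → u = v

/-- The identification `i ↔ xⁱ` is injective, coordinatewise. [cite: CohnUmans2003, Prop. 19 (arXiv numbering), proof] -/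
theorem rotationTuple_injective : Function.Injective (rotationTuple (m := m) (k := k)) := by
  intro v w h
  funext i
  have := congr_fun h i
  simpa [rotationTuple] using this

/-- `|⟨y⟩ᵏ| = 2ᵏ` (needs `y ≠ 1`, automatic). [cite: CohnUmans2003, Prop. 19 (arXiv numbering)] -/
theorem card_spernerY : (spernerY m k).card = 2 ^ k := by
  rw [spernerY, Fintype.card_piFinset, prod_const, card_univ, Fintype.card_fin,
    card_pair (by rw [Ne, DihedralGroup.one_def]; intro h; cases h)]

/-- `|⟨yx⟩ᵏ| = 2ᵏ`. [cite: CohnUmans2003, Prop. 19 (arXiv numbering)] -/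
theorem card_spernerYX : (spernerYX m k).card = 2 ^ k := by
  rw [spernerYX, Fintype.card_piFinset, prod_const, card_univ, Fintype.card_fin,
    card_pair (by rw [Ne, DihedralGroup.one_def]; intro h; cases h)]

/-- `|S| = |rotationSet S|`. [cite: CohnUmans2003, Prop. 19 (arXiv numbering)] -/
theorem card_rotationSet (S : Finset (Fin k → ZMod m)) : (rotationSet S).card = S.card :=
  card_image_of_injective _ rotationTuple_injective

/-- The coordinate computation "`⟨y⟩⟨yx⟩ = {1, y, yx, x}`" and "`(⟨y⟩⟨yx⟩) ∩ ⟨x⟩ = {1, x}`": for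
`p ∈ ⟨y⟩`, `q ∈ ⟨yx⟩` and a rotation `x^d` with `p q x^d = 1`, either `p = q = 1` and `d = 0`, or
`p = y`, `q = yx` and `x^d = x⁻¹`. [cite: CohnUmans2003, Prop. 19 (arXiv numbering), proof] -/
theorem coord_cases {p q : DihedralGroup m} (hp : p = 1 ∨ p = DihedralGroup.sr 0)
    (hq : q = 1 ∨ q = DihedralGroup.sr 1) {d : ZMod m} (h : p * q * DihedralGroup.r d = 1) :
    (p = 1 ∧ q = 1 ∧ d = 0) ∨ (p = DihedralGroup.sr 0 ∧ q = DihedralGroup.sr 1 ∧ d + 1 = 0) := by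
  rcases hp with rfl | rfl <;> rcases hq with rfl | rfl
  · left
    refine ⟨rfl, rfl, ?_⟩
    rw [one_mul, one_mul, DihedralGroup.one_def] at h
    exact DihedralGroup.r.inj h
  · exfalso
    rw [one_mul, DihedralGroup.sr_mul_r, DihedralGroup.one_def] at h
    cases h
  · exfalso
    rw [mul_one, DihedralGroup.sr_mul_r, DihedralGroup.one_def] at h
    cases h
  · right
    refine ⟨rfl, rfl, ?_⟩
    rw [DihedralGroup.sr_mul_sr, DihedralGroup.r_mul_r, DihedralGroup.one_def] at h
    have := DihedralGroup.r.inj h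
    linear_combination this

/-- Right quotients stay in `⟨y⟩` (a subgroup of order `2`). [folklore] -/
private theorem quot_mem_Y {a a' : DihedralGroup m} (ha : a = 1 ∨ a = DihedralGroup.sr 0)
    (ha' : a' = 1 ∨ a' = DihedralGroup.sr 0) : a * a'⁻¹ = 1 ∨ a * a'⁻¹ = DihedralGroup.sr 0 := by
  rcases ha with rfl | rfl <;> rcases ha' with rfl | rfl <;> simp

/-- Right quotients stay in `⟨yx⟩` (a subgroup of order `2`). [folklore] -/
private theorem quot_mem_YX {a a' : DihedralGroup m} (ha : a = 1 ∨ a = DihedralGroup.sr 1)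
    (ha' : a' = 1 ∨ a' = DihedralGroup.sr 1) : a * a'⁻¹ = 1 ∨ a * a'⁻¹ = DihedralGroup.sr 1 := by
  rcases ha with rfl | rfl <;> rcases ha' with rfl | rfl <;> simp

end SpernerTPP

open SpernerTPP

/-- **Cohn–Umans 2003, Prop. 19 (arXiv numbering), the triple product property**: if no two distinct
vectors of `S ⊆ (ℤ/mℤ)ᵏ` differ by an element of `{0,1}ᵏ` (and `m ≠ 1`), then `⟨y⟩ᵏ`, `⟨yx⟩ᵏ` and
`S ⊆ ⟨x⟩ᵏ` satisfy the triple product property in `D_mᵏ`.  Proof as printed, coordinate by coordinate: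
`sᵢs'ᵢ⁻¹ ∈ ⟨y⟩`, `tᵢt'ᵢ⁻¹ ∈ ⟨yx⟩`, `uᵢu'ᵢ⁻¹ = x^{wᵢ−w'ᵢ}`, and `⟨y⟩⟨yx⟩ ∩ ⟨x⟩ = {1, x}` forces
`w' − w ∈ {0,1}ᵏ`, hence `w = w'`, hence every coordinate quotient is `1`.
[cite: CohnUmans2003, Prop. 19 (arXiv numbering)] -/
theorem CohnUmans2003_prop19_tpp {m k : ℕ} (hm : m ≠ 1) {S : Finset (Fin k → ZMod m)}
    (hS : SpernerCondition S) :
    TripleProductProperty (spernerY m k) (spernerYX m k) (rotationSet S) := by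
  intro s hs s' hs' t ht t' ht' u hu u' hu' h
  simp only [spernerY, spernerYX, Fintype.mem_piFinset, mem_insert, mem_singleton] at hs hs' ht ht'
  simp only [rotationSet, mem_image] at hu hu'
  obtain ⟨w, hw, rfl⟩ := hu
  obtain ⟨w', hw', rfl⟩ := hu'
  -- coordinate `i`: `(sᵢ s'ᵢ⁻¹)(tᵢ t'ᵢ⁻¹) x^{wᵢ - w'ᵢ} = 1`
  have hco : ∀ i, (s i * (s' i)⁻¹ = 1 ∧ t i * (t' i)⁻¹ = 1 ∧ w i - w' i = 0) ∨
      (s i * (s' i)⁻¹ = DihedralGroup.sr 0 ∧ t i * (t' i)⁻¹ = DihedralGroup.sr 1 ∧ w i - w' i + 1 = 0) := by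
    intro i
    have hi := congr_fun h i
    simp only [Pi.mul_apply, Pi.inv_apply, Pi.one_apply, rotationTuple, DihedralGroup.inv_r,
      DihedralGroup.r_mul_r, ← sub_eq_add_neg] at hi
    exact coord_cases (quot_mem_Y (hs i) (hs' i)) (quot_mem_YX (ht i) (ht' i)) hi
  -- `w' - w ∈ {0,1}ᵏ`, hence `w = w'`
  have hww : w = w' := hS w hw w' hw' fun i => by
    rcases hco i with ⟨-, -, h0⟩ | ⟨-, -, h1⟩
    · left; linear_combination -h0
    · right; linear_combination -h1
  subst hww
  have hm' : (1 : ZMod m) ≠ 0 := by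
    rcases Nat.eq_zero_or_pos m with h0 | hpos
    · subst h0; exact one_ne_zero
    · haveI : Fact (1 < m) := ⟨lt_of_le_of_ne hpos (Ne.symm hm)⟩
      exact one_ne_zero
  have hall : ∀ i, s i = s' i ∧ t i = t' i := fun i => by
    rcases hco i with ⟨h1, h2, -⟩ | ⟨-, -, h3⟩
    · exact ⟨mul_inv_eq_one.mp h1, mul_inv_eq_one.mp h2⟩
    · exact absurd (by simpa using h3) hm'
  exact ⟨funext fun i => (hall i).1, funext fun i => (hall i).2, rfl⟩

/-- **Cohn–Umans 2003, Prop. 19 (arXiv numbering)**: "If `S ⊆ (ℤ/mℤ)ᵏ` is a subset in which no two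
distinct vectors differ by an element of `{0,1}ᵏ`, then `D_mᵏ` realizes `⟨2ᵏ, 2ᵏ, |S|⟩`" (through
`⟨y⟩ᵏ`, `⟨yx⟩ᵏ` and `S ⊆ ⟨x⟩ᵏ`; `m ≠ 1`).  In the tree's `RealizesTPP`.
[cite: CohnUmans2003, Prop. 19 (arXiv numbering)] -/
theorem CohnUmans2003_prop19 {m k : ℕ} (hm : m ≠ 1) {S : Finset (Fin k → ZMod m)}
    (hS : SpernerCondition S) :
    RealizesTPP (Fin k → DihedralGroup m) (2 ^ k) (2 ^ k) S.card :=
  ⟨spernerY m k, spernerYX m k, rotationSet S, card_spernerY, card_spernerYX, card_rotationSet S,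
    CohnUmans2003_prop19_tpp hm hS⟩

/-! ### The Sperner-capacity set of Cohn–Umans (the construction behind Cor. 20) -/

namespace SpernerTPP

/-- **Cohn–Umans' Sperner-capacity set**: "take `S` to be the set of all vectors in `(ℤ/mℤ)ᵏ` with exactly
`k/(m−1)` occurrences of each element of `{0,1,…,m−2}`" — here with `q` occurrences of each residue
`j ≠ −1 (= m−1)` (so `S = ∅` unless `k = (m−1)q`). [cite: CohnUmans2003, Cor. 20 (arXiv numbering), construction before it] -/
def spernerSet (m k q : ℕ) [NeZero m] : Finset (Fin k → ZMod m) :=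
  Finset.univ.filter fun v => ∀ j : ZMod m, j ≠ -1 → (Finset.univ.filter fun i => v i = j).card = q

variable {m k q : ℕ} [NeZero m]

/-- Membership in the Sperner-capacity set. [cite: CohnUmans2003, Cor. 20 (arXiv numbering), construction before it] -/
theorem mem_spernerSet {v : Fin k → ZMod m} :
    v ∈ spernerSet m k q ↔ ∀ j : ZMod m, j ≠ -1 → (Finset.univ.filter fun i => v i = j).card = q := by
  simp [spernerSet]

/-- A vector of the Sperner-capacity set has no entry `−1 = m−1` when `k = (m−1)q` (the counts of the
other `m−1` residues already exhaust the `k` coordinates). [cite: CohnUmans2003, Cor. 20 (arXiv numbering), construction before it] -/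
theorem apply_ne_neg_one_of_mem_spernerSet (hk : k = (m - 1) * q) {v : Fin k → ZMod m}
    (hv : v ∈ spernerSet m k q) (i : Fin k) : v i ≠ -1 := by
  classical
  rw [mem_spernerSet] at hv
  -- `k = Σ_j #{v = j} = (m-1) q + #{v = -1}`
  have hsum : ∑ j : ZMod m, (Finset.univ.filter fun i => v i = j).card = k := by
    rw [← Finset.card_eq_sum_card_fiberwise (f := v) (s := Finset.univ) (t := Finset.univ)
      (fun _ _ => Finset.mem_univ _), Finset.card_univ, Fintype.card_fin]
  rw [← Finset.sum_erase_add _ _ (Finset.mem_univ (-1 : ZMod m))] at hsum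
  have hrest : ∑ j ∈ (Finset.univ : Finset (ZMod m)).erase (-1),
      (Finset.univ.filter fun i => v i = j).card = (m - 1) * q := by
    rw [Finset.sum_congr rfl (fun j hj => hv j (Finset.ne_of_mem_erase hj)), Finset.sum_const,
      smul_eq_mul, Finset.card_erase_of_mem (Finset.mem_univ _), Finset.card_univ, ZMod.card]
  rw [hrest, ← hk] at hsum
  have hzero : (Finset.univ.filter fun i => v i = -1).card = 0 := by omega
  intro h
  have : i ∈ (Finset.univ.filter fun i => v i = -1) := Finset.mem_filter.mpr ⟨Finset.mem_univ _, h⟩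
  rw [Finset.card_eq_zero.mp hzero] at this
  exact Finset.notMem_empty _ this

/-- **The Sperner-capacity set satisfies the hypothesis of Prop. 19** ("Now suppose we have `u, v ∈ S` with
`u − v ∈ {0,1}ᵏ`. For each coordinate `i` such that `uᵢ = 0`, we have `vᵢ ∈ {0, m−1}` … and thus `vᵢ = 0`.
Then whenever `uᵢ = 1`, it follows that `vᵢ = 1`, because all `k/(m−1)` cases in which `vᵢ = 0` have
`uᵢ = 0` as well. Repeating this argument yields `u = v`"), for `m ≥ 2` and `k = (m−1)q`.
[cite: CohnUmans2003, Cor. 20 (arXiv numbering), construction before it] -/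
theorem spernerCondition_spernerSet (hm : 1 < m) (hk : k = (m - 1) * q) :
    SpernerCondition (spernerSet m k q) := by
  classical
  intro u hu v hv hdiff
  -- printed orientation: `u - v ∈ {0,1}ᵏ` is our `v - u ∈ {0,1}ᵏ` with the roles of `u`, `v` exchanged;
  -- we prove `{v = j} = {u = j}` for `j = 0, 1, …, m-2` by induction on `j`.
  have hu1 := apply_ne_neg_one_of_mem_spernerSet hk hu
  have hv1 := apply_ne_neg_one_of_mem_spernerSet hk hv
  rw [mem_spernerSet] at hu hv
  haveI : Fact (1 < m) := ⟨hm⟩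
  -- each coordinate: `u i = v i` or `u i = v i - 1`
  have hstep : ∀ i, u i = v i ∨ u i = v i - 1 := fun i => by
    rcases hdiff i with h | h
    · left; linear_combination -h
    · right; linear_combination -h
  -- induction on the natural representative `j`
  have key : ∀ j : ℕ, j + 1 < m → ∀ i, v i = (j : ZMod m) → u i = (j : ZMod m) := by
    intro j
    induction j with
    | zero =>
      intro _ i hvi
      rcases hstep i with h | h
      · rw [h, hvi]
      · exfalso
        apply hu1 i
        rw [h, hvi, Nat.cast_zero, zero_sub]
    | succ j ih =>
      intro hj i hvi
      rcases hstep i with h | h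
      · rw [h, hvi]
      · exfalso
        -- `u i = j`, so by the induction hypothesis the `j`-fibres of `u` and `v` coincide, and `i` lies in
        -- the `j`-fibre of `u` but not of `v`
        have hj' : j + 1 < m := by omega
        have huj : u i = (j : ZMod m) := by rw [h, hvi]; push_cast; ring
        have hsub : (Finset.univ.filter fun i => v i = (j : ZMod m)) ⊆
            (Finset.univ.filter fun i => u i = (j : ZMod m)) := by
          intro i' hi'
          rw [Finset.mem_filter] at hi' ⊢
          exact ⟨hi'.1, ih hj' i' hi'.2⟩
        have hjne : (j : ZMod m) ≠ -1 := by
          intro hj1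
          have : ((j + 1 : ℕ) : ZMod m) = 0 := by push_cast; rw [hj1]; ring
          rw [ZMod.natCast_eq_zero_iff] at this
          exact absurd (Nat.le_of_dvd (Nat.succ_pos j) this) (by omega)
        have hcard : (Finset.univ.filter fun i => u i = (j : ZMod m)).card ≤
            (Finset.univ.filter fun i => v i = (j : ZMod m)).card := by
          rw [hu _ hjne, hv _ hjne]
        have heq := Finset.eq_of_subset_of_card_le hsub hcard
        have hi : i ∈ (Finset.univ.filter fun i => u i = (j : ZMod m)) :=
          Finset.mem_filter.mpr ⟨Finset.mem_univ _, huj⟩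
        rw [← heq, Finset.mem_filter] at hi
        have : (j : ZMod m) + 1 = (j : ZMod m) := by
          have e := hi.2  -- v i = j
          rw [hvi] at e
          push_cast at e
          exact e
        have h10 : (1 : ZMod m) = 0 := by linear_combination this
        exact one_ne_zero h10
  funext i
  -- `v i = j` for some natural `j ≤ m - 2`
  have hval : v i = ((v i).val : ZMod m) := (ZMod.natCast_zmod_val (v i)).symm
  have hlt : (v i).val + 1 < m := by
    have h1 : (v i).val < m := ZMod.val_lt (v i)
    rcases Nat.lt_or_ge ((v i).val + 1) m with h | h
    · exact h
    · exfalso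
      apply hv1 i
      have hvm : (v i).val = m - 1 := by omega
      rw [hval, hvm, Nat.cast_sub (by omega), Nat.cast_one, ZMod.natCast_self, zero_sub]
  exact (key (v i).val hlt i hval).trans hval.symm

end SpernerTPP

/-- **Cohn–Umans 2003, the Sperner-capacity TPP family** (Prop. 19 applied to the set of the construction
before Cor. 20): for `m ≥ 2` and `k = (m−1)q`, `D_mᵏ` realizes `⟨2ᵏ, 2ᵏ, |S_{m,k}|⟩` with `S_{m,k}` the vectors
having exactly `q` occurrences of each residue `0, …, m−2` ("`|S| = (m−1)^{(1−o(1))k}`", whence Cor. 20,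
`α(D_4ᵏ) ≤ (3+o(1)) log_12 8` — the asymptotics are not formalised).
[cite: CohnUmans2003, Prop. 19 and Cor. 20 (arXiv numbering)] -/
theorem CohnUmans2003_prop19_spernerSet {m k q : ℕ} [NeZero m] (hm : 1 < m) (hk : k = (m - 1) * q) :
    RealizesTPP (Fin k → DihedralGroup m) (2 ^ k) (2 ^ k) (SpernerTPP.spernerSet m k q).card :=
  CohnUmans2003_prop19 (by omega) (SpernerTPP.spernerCondition_spernerSet hm hk)

end Literature.Computability.AlgebraicComplexity
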